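import Mathlib
import HarnessLib
import Literature.MathematicalPhysics.KineticTheory.HardSphereEulerProofs
import Literature.Analysis.FluidPDE.HardSphereFlowJointMeasurable

/-!
# Ledger assembly for the crux `KineticCurrentsWindowLDUniform` (stmt-AtomisticToContinuum-14662),
# line `local-gibbs-entropy-ledger`, stub `stub_localGibbsLedgerAssemblyByName` (S7') — helper file:
# the window-mean identity, Cesàro averages of one-body laws, `ℝ≥0∞` glue

Helper file (no dynamics beyond energy conservation and joint measurability of the flow) of the
registered stub `stub_localGibbsLedgerAssemblyByName` of the line skeleton
`Cruxes/KineticCurrentsWindowLDUniform/Lines/local_gibbs_entropy_ledger.lean`, landed in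
`…LocalGibbsLedgerAssembly.lean`.  Contents (prefix `lga_`):

* `lga_natCast_add_one`, `lga_toReal_inv_natCast_add_one`, `lga_marginal_bound`, `lga_h4_rhs`,
  `lga_lintegral_affine_bound`, `lga_le_of_inv_mul_le` — `ℝ≥0∞ ↔ ℝ` bookkeeping used when the three
  entropy ledgers are chained and integrated over the kinetic window;
* `lga_isProbabilityMeasure_avg`, `lga_integral_avg` — the Cesàro average
  `f̄ = (N+1)⁻¹ Σᵢ μᵢ` of `N + 1` probability measures is a probability measure and
  `∫ F df̄ = (N+1)⁻¹ Σᵢ ∫ F dμᵢ`;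
* `lga_aemeasurable_comp_flow_prod` — `(z, r) ↦ f(Φ_r z)` is a.e.-measurable for `Q ⊗ ν` whenever
  `Q` is carried by the good set (`HardSphereFlow.measurable_flow_prod_torus`);
* `lga_abs_obs_flow_le`, `lga_integrable_obs_flow`, `lga_window_fubini` and the registered
  principal statement `stub_localGibbsLedgerAssemblyByName_prelim` — for a continuous one-body
  observable `F` with `|F(x,v)| ≤ C(1+‖v‖²)` and a finite measure `Q` carried by the good set under
  which the (conserved) energy `Σᵢ‖vᵢ‖²` is integrable, Fubini over `[0,w] × phase space` gives the
  WINDOW-MEAN IDENTITY `∫ Σᵢ w⁻¹∫₀ʷ F((Φ_r z)ᵢ) dr dQ = w⁻¹ ∫₀ʷ Σᵢ ∫ F((Φ_r z)ᵢ) dQ dr`.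

References: C. Kipnis, C. Landim, *Scaling Limits of Interacting Particle Systems* (1999), Ch. 6
(relative entropy method: the only use of the dynamics in the entropy ledger is through one-time
marginals); C. Cercignani, R. Illner, M. Pulvirenti, *The Mathematical Theory of Dilute Gases*
(1994), §4.2 (measurability of the hard-sphere flow).
-/

noncomputable section

open MeasureTheory Set Filter
open scoped ENNReal Topology

namespace Summit.AtomisticToContinuum.HydrodynamicLimit.Theorems.KineticCurrentsWindowLDUniformLocalGibbs

open Literature.Analysis.FluidPDE (HardSphereFlow Config configEnergy IsHardSphereTrajectory)
open Literature.MathematicalPhysics.KineticTheory (T3 V3 hsDiameter)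

/-! ### `ℝ≥0∞` glue -/

/-- `(N : ℝ≥0∞) + 1 = ofReal ((N : ℝ) + 1)`. [folklore] -/
theorem lga_natCast_add_one (N : ℕ) : ((N : ℝ≥0∞) + 1) = ENNReal.ofReal ((N : ℝ) + 1) := by
  rw [ENNReal.ofReal_add (Nat.cast_nonneg N) zero_le_one, ENNReal.ofReal_natCast, ENNReal.ofReal_one]

/-- `(N : ℝ≥0∞) + 1` is neither `0` nor `⊤`. [folklore] -/
theorem lga_natCast_add_one_ne (N : ℕ) : ((N : ℝ≥0∞) + 1) ≠ 0 ∧ ((N : ℝ≥0∞) + 1) ≠ ⊤ :=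
  ⟨ne_of_gt (by positivity), ENNReal.add_ne_top.2 ⟨ENNReal.natCast_ne_top N, ENNReal.one_ne_top⟩⟩

/-- `((N : ℝ≥0∞) + 1)⁻¹` has real part `((N : ℝ) + 1)⁻¹`. [folklore] -/
theorem lga_toReal_inv_natCast_add_one (N : ℕ) :
    (((N : ℝ≥0∞) + 1)⁻¹).toReal = ((N : ℝ) + 1)⁻¹ := by
  rw [ENNReal.toReal_inv, lga_natCast_add_one, ENNReal.toReal_ofReal (by positivity)]

/-- Chaining the marginal ledger `(N+1)·𝓗 ≤ A` with the quasi-invariance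
`A ≤ c·KL + δ(N+1)` (`KL = ofReal k` finite): `𝓗 ≤ ofReal (c·k/(N+1) + δ)`. [folklore] -/
theorem lga_marginal_bound {N : ℕ} {H A : ℝ≥0∞} {c δ k : ℝ} (hc : 0 ≤ c) (hδ : 0 ≤ δ)
    (hk : 0 ≤ k) (h2 : ((N : ℝ≥0∞) + 1) * H ≤ A)
    (h3 : A ≤ ENNReal.ofReal c * ENNReal.ofReal k + ENNReal.ofReal (δ * ((N : ℝ) + 1))) :
    H ≤ ENNReal.ofReal (c * (k / ((N : ℝ) + 1)) + δ) := by
  have hN : (0 : ℝ) < (N : ℝ) + 1 := by positivity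
  have heq : ENNReal.ofReal c * ENNReal.ofReal k + ENNReal.ofReal (δ * ((N : ℝ) + 1)) =
      ((N : ℝ≥0∞) + 1) * ENNReal.ofReal (c * (k / ((N : ℝ) + 1)) + δ) := by
    rw [← ENNReal.ofReal_mul hc, ← ENNReal.ofReal_add (by positivity) (by positivity),
      lga_natCast_add_one, ← ENNReal.ofReal_mul hN.le]
    congr 1
    field_simp
  have h := h2.trans (h3.trans_eq heq)
  exact (ENNReal.mul_le_mul_iff_right (lga_natCast_add_one_ne N).1 (lga_natCast_add_one_ne N).2).1 h

/-- The right-hand side of the integrated kinetic-entropy bound in real form: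
`ofReal ε' * (ofReal k / (N+1) + 1) = ofReal (ε' (k/(N+1) + 1))`. [folklore] -/
theorem lga_h4_rhs (N : ℕ) {ε' k : ℝ} (hε' : 0 ≤ ε') (hk : 0 ≤ k) :
    ENNReal.ofReal ε' * (ENNReal.ofReal k / ((N : ℝ≥0∞) + 1) + 1) =
      ENNReal.ofReal (ε' * (k / ((N : ℝ) + 1) + 1)) := by
  rw [lga_natCast_add_one, ← ENNReal.ofReal_div_of_pos (by positivity), ← ENNReal.ofReal_one,
    ← ENNReal.ofReal_add (by positivity) zero_le_one, ← ENNReal.ofReal_mul hε']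

/-- Integrating an affine bound `φ r ≤ ofReal A + ofReal L · 𝒦 r` over the window `[0, w]`
(no measurability needed). [folklore] -/
theorem lga_lintegral_affine_bound {w A L : ℝ} (hA : 0 ≤ A)
    {φ 𝒦 : ℝ → ℝ≥0∞} (h : ∀ r ∈ Icc (0 : ℝ) w, φ r ≤ ENNReal.ofReal A + ENNReal.ofReal L * 𝒦 r) :
    ∫⁻ r in Icc (0 : ℝ) w, φ r ≤
      ENNReal.ofReal (A * w) + ENNReal.ofReal L * ∫⁻ r in Icc (0 : ℝ) w, 𝒦 r := by
  calc ∫⁻ r in Icc (0 : ℝ) w, φ r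
      ≤ ∫⁻ r in Icc (0 : ℝ) w, (ENNReal.ofReal A + ENNReal.ofReal L * 𝒦 r) :=
        setLIntegral_mono' measurableSet_Icc h
    _ = (∫⁻ _ in Icc (0 : ℝ) w, ENNReal.ofReal A) + ∫⁻ r in Icc (0 : ℝ) w, ENNReal.ofReal L * 𝒦 r :=
        lintegral_add_left measurable_const _
    _ = ENNReal.ofReal (A * w) + ENNReal.ofReal L * ∫⁻ r in Icc (0 : ℝ) w, 𝒦 r := by
        rw [setLIntegral_const, Real.volume_Icc, sub_zero, ← ENNReal.ofReal_mul hA,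
          lintegral_const_mul' _ _ ENNReal.ofReal_ne_top]

/-- `(ofReal w)⁻¹ · X ≤ Y` with `w > 0` gives `X ≤ ofReal w · Y`. [folklore] -/
theorem lga_le_of_inv_mul_le {w : ℝ} (hw : 0 < w) {X Y : ℝ≥0∞}
    (h : (ENNReal.ofReal w)⁻¹ * X ≤ Y) : X ≤ ENNReal.ofReal w * Y := by
  have hw0 : ENNReal.ofReal w ≠ 0 := (ENNReal.ofReal_pos.2 hw).ne'
  calc X = ENNReal.ofReal w * ((ENNReal.ofReal w)⁻¹ * X) := by
        rw [← mul_assoc, ENNReal.mul_inv_cancel hw0 ENNReal.ofReal_ne_top, one_mul]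
    _ ≤ ENNReal.ofReal w * Y := by gcongr

/-- Collecting the window bound: `ofReal (A w) + ofReal L · (ofReal w · ofReal e) = ofReal (w (A + L e))`. [folklore] -/
theorem lga_window_collect {w A L e : ℝ} (hw : 0 ≤ w) (hA : 0 ≤ A) (hL : 0 ≤ L) (he : 0 ≤ e) :
    ENNReal.ofReal (A * w) + ENNReal.ofReal L * (ENNReal.ofReal w * ENNReal.ofReal e) =
      ENNReal.ofReal (w * (A + L * e)) := by
  rw [← ENNReal.ofReal_mul hw, ← ENNReal.ofReal_mul hL, ← ENNReal.ofReal_add (mul_nonneg hA hw)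
    (mul_nonneg hL (mul_nonneg hw he))]
  congr 1
  ring

/-- A Bochner integral is bounded by the real part of a bound on the lower integral of the
absolute value over a larger set. [folklore] -/
theorem lga_abs_setIntegral_le {s t : Set ℝ} (hst : s ⊆ t) {φ : ℝ → ℝ} {B : ℝ} (hB : 0 ≤ B)
    (h : ∫⁻ r in t, ENNReal.ofReal |φ r| ≤ ENNReal.ofReal B) : |∫ r in s, φ r| ≤ B := by
  have h1 := norm_integral_le_lintegral_norm (μ := volume.restrict s) φ
  rw [Real.norm_eq_abs] at h1
  refine h1.trans ?_
  have h2 : ∫⁻ r in s, ENNReal.ofReal ‖φ r‖ ≤ ENNReal.ofReal B :=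
    (lintegral_mono_set hst).trans (le_of_eq_of_le (lintegral_congr fun r => by rw [Real.norm_eq_abs]) h)
  exact (ENNReal.toReal_mono ENNReal.ofReal_ne_top h2).trans_eq (ENNReal.toReal_ofReal hB)

/-- Scaling the window bound: `|I| ≤ w B` gives `β · w⁻¹ (n I) ≤ |β| (n B)` (`w, n > 0`). [folklore] -/
theorem lga_scale_bound {β w n I B : ℝ} (hw : 0 < w) (hn : 0 < n) (hI : |I| ≤ w * B) :
    β * (w⁻¹ * (n * I)) ≤ |β| * (n * B) := by
  have hB : w⁻¹ * |I| ≤ B := by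
    rw [inv_mul_le_iff₀ hw]
    exact hI
  calc β * (w⁻¹ * (n * I)) = n * (β * (w⁻¹ * I)) := by ring
    _ ≤ n * |β * (w⁻¹ * I)| := mul_le_mul_of_nonneg_left (le_abs_self _) hn.le
    _ = n * (|β| * (w⁻¹ * |I|)) := by rw [abs_mul, abs_mul, abs_of_pos (inv_pos.2 hw)]
    _ ≤ n * (|β| * B) := mul_le_mul_of_nonneg_left (mul_le_mul_of_nonneg_left hB (abs_nonneg β)) hn.le
    _ = |β| * (n * B) := by ring

/-- The ledger arithmetic: with `t K c ≤ 1/4`, `t L ε' ≤ min (1/4) (ε/8)`, `t K δ ≤ ε/2` and `h ≥ 0`,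
`t (K (c h + δ) + L ε' (h + 1)) − h ≤ ε`. [folklore] -/
theorem lga_ledger_arith {t K L c h δ ε' ε : ℝ} (hh : 0 ≤ h) (hε : 0 ≤ ε)
    (hKc : t * (K * c) ≤ 1 / 4) (hLε1 : t * L * ε' ≤ 1 / 4) (hLε2 : t * L * ε' ≤ ε / 8)
    (hKδ : t * K * δ ≤ ε / 2) : t * (K * (c * h + δ) + L * (ε' * (h + 1))) - h ≤ ε := by
  have p1 : t * (K * c) * h ≤ 1 / 4 * h := mul_le_mul_of_nonneg_right hKc hh
  have p3 : t * L * ε' * h ≤ 1 / 4 * h := mul_le_mul_of_nonneg_right hLε1 hh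
  nlinarith

/-- The final ledger: `log Z = β E_Q S − KL`, `KL = n h`, `β E_Q S ≤ |β| n B`, `|β| B − h ≤ ε` give
`log Z ≤ ε n`. [folklore] -/
theorem lga_log_bound {logZ β IS KL n B h ε : ℝ} (hK : KL = β * IS - logZ) (hKL : KL = n * h)
    (hES : β * IS ≤ |β| * (n * B)) (hbr : |β| * B - h ≤ ε) (hn : 0 ≤ n) : logZ ≤ ε * n := by
  have h1 : logZ = β * IS - n * h := by linarith
  rw [h1]
  nlinarith [mul_le_mul_of_nonneg_left hbr hn]

/-! ### Cesàro averages of one-body laws -/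

section Average

variable {α : Type*} [MeasurableSpace α] {N : ℕ}

/-- The Cesàro average `(N+1)⁻¹ Σᵢ μᵢ` of `N + 1` probability measures is a probability measure. [folklore] -/
theorem lga_isProbabilityMeasure_avg (μ : Fin (N + 1) → Measure α) [∀ i, IsProbabilityMeasure (μ i)] :
    IsProbabilityMeasure (((N : ℝ≥0∞) + 1)⁻¹ • ∑ i : Fin (N + 1), μ i) := by
  refine ⟨?_⟩
  simp only [Measure.smul_apply, Measure.coe_finsetSum, Finset.sum_apply, measure_univ,
    Finset.sum_const, Finset.card_univ, Fintype.card_fin, nsmul_eq_mul, mul_one, smul_eq_mul]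
  push_cast
  exact ENNReal.inv_mul_cancel (lga_natCast_add_one_ne N).1 (lga_natCast_add_one_ne N).2

/-- Integration against the Cesàro average: `∫ F d((N+1)⁻¹ Σᵢ μᵢ) = (N+1)⁻¹ Σᵢ ∫ F dμᵢ` for `F`
integrable under each `μᵢ`. [folklore] -/
theorem lga_integral_avg (μ : Fin (N + 1) → Measure α) {F : α → ℝ}
    (hF : ∀ i, Integrable F (μ i)) :
    ∫ x, F x ∂(((N : ℝ≥0∞) + 1)⁻¹ • ∑ i : Fin (N + 1), μ i) =
      ((N : ℝ) + 1)⁻¹ * ∑ i : Fin (N + 1), ∫ x, F x ∂(μ i) := by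
  rw [integral_smul_measure, integral_finsetSum_measure fun i _ => hF i,
    lga_toReal_inv_natCast_add_one, smul_eq_mul]

end Average

/-! ### Observables along the flow: measurability, energy domination, window Fubini -/

section Flow

/-- **Joint a.e.-measurability along the flow.** For a hard-sphere flow `Φ` on a flat torus, a
measurable `f` on phase space, a measure `Q` carried by the good set and any measure `ν` on `ℝ`,
`(z, r) ↦ f (Φ_r z)` is a.e.-measurable for `Q ⊗ ν` (it is measurable on the conull measurable
set `good × ℝ`, `HardSphereFlow.measurable_flow_prod_torus`). [folklore] -/
theorem lga_aemeasurable_comp_flow_prod {d : Type*} [Fintype d] {n : ℕ} {ε : ℝ}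
    (Φ : HardSphereFlow (Literature.Analysis.FluidPDE.Torus.geometry d) ε n)
    {β : Type*} [MeasurableSpace β] {f : Config n d (UnitAddTorus d) → β} (hf : Measurable f)
    {Q : Measure (Config n d (UnitAddTorus d))} (hQ : Q Φ.goodᶜ = 0) (ν : Measure ℝ) :
    AEMeasurable (fun p : Config n d (UnitAddTorus d) × ℝ => f (Φ.flow p.2 p.1)) (Q.prod ν) := by
  set S : Set (Config n d (UnitAddTorus d) × ℝ) := Φ.good ×ˢ (univ : Set ℝ) with hS
  have hSm : MeasurableSet S := Φ.measurableSet_good.prod MeasurableSet.univ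
  have hflowS : Measurable fun p : S => f (Φ.flow p.1.2 p.1.1) := by
    have hmk : Measurable fun p : S => ((⟨p.1.1, (mem_prod.1 p.2).1⟩ : Φ.good), p.1.2) :=
      ((measurable_fst.comp measurable_subtype_coe).subtype_mk).prodMk
        (measurable_snd.comp measurable_subtype_coe)
    exact hf.comp ((Φ.measurable_flow_prod_torus).comp hmk)
  have hSc : (Q.prod ν) Sᶜ = 0 := by
    have hsub : Sᶜ ⊆ Φ.goodᶜ ×ˢ (univ : Set ℝ) := by
      intro p hp
      simp only [hS, mem_compl_iff, mem_prod, mem_univ, and_true] at hp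
      exact ⟨hp, mem_univ _⟩
    refine measure_mono_null hsub (le_antisymm ?_ bot_le)
    calc (Q.prod ν) (Φ.goodᶜ ×ˢ (univ : Set ℝ)) ≤ Q Φ.goodᶜ * ν univ := Measure.prod_prod_le _ _
      _ = 0 := by rw [hQ, zero_mul]
  have h := aemeasurable_restrict_of_measurable_subtype (μ := Q.prod ν)
    (f := fun p : Config n d (UnitAddTorus d) × ℝ => f (Φ.flow p.2 p.1)) hSm hflowS
  have hae : ∀ᵐ p ∂(Q.prod ν), p ∈ S := mem_ae_iff.2 hSc
  rwa [Measure.restrict_eq_self_of_ae_mem hae] at h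

variable {σ : ℝ} {N : ℕ}
  (Φ : HardSphereFlow (Literature.Analysis.FluidPDE.Torus.geometry (Fin 3)) (hsDiameter σ N) (N + 1))
  {F : T3 × V3 → ℝ} {C : ℝ}

/-- Energy domination on the good set: `|F((Φ_r z)ᵢ)| ≤ C (1 + Σⱼ ‖vⱼ‖²)` for `|F(x,v)| ≤ C(1+‖v‖²)`
(conservation of the kinetic energy, `IsHardSphereTrajectory.configEnergy_eq_holds`). [folklore] -/
theorem lga_abs_obs_flow_le (hC0 : 0 ≤ C) (hC : ∀ y, |F y| ≤ C * (1 + ‖y.2‖ ^ 2))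
    {z : Config (N + 1) (Fin 3) T3} (hz : z ∈ Φ.good) (r : ℝ) (i : Fin (N + 1)) :
    |F ((Φ.flow r z) i)| ≤ C * (1 + ∑ j, ‖(z j).2‖ ^ 2) := by
  have hE : ∑ j, ‖((Φ.flow r z) j).2‖ ^ 2 = ∑ j, ‖(z j).2‖ ^ 2 := by
    have h := IsHardSphereTrajectory.configEnergy_eq_holds (Φ.isTrajectory z hz) r 0
    simp only [Φ.flow_zero z hz, configEnergy] at h
    exact mul_left_cancel₀ (by norm_num : (2 : ℝ)⁻¹ ≠ 0) h
  have hle : ‖((Φ.flow r z) i).2‖ ^ 2 ≤ ∑ j, ‖(z j).2‖ ^ 2 := by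
    rw [← hE]
    exact Finset.single_le_sum (f := fun j => ‖((Φ.flow r z) j).2‖ ^ 2) (fun j _ => by positivity)
      (Finset.mem_univ i)
  exact (hC _).trans (mul_le_mul_of_nonneg_left (by linarith) hC0)

variable {Q : Measure (Config (N + 1) (Fin 3) T3)}

/-- At every fixed time, the observable along the flow is integrable under a law carried by the good
set with integrable energy. [folklore] -/
theorem lga_integrable_obs_flow [IsFiniteMeasure Q] (hFc : Continuous F) (hC0 : 0 ≤ C)
    (hC : ∀ y, |F y| ≤ C * (1 + ‖y.2‖ ^ 2)) (hQ : Q Φ.goodᶜ = 0)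
    (hE : Integrable (fun z : Config (N + 1) (Fin 3) T3 => ∑ j, ‖(z j).2‖ ^ 2) Q) (r : ℝ)
    (i : Fin (N + 1)) : Integrable (fun z => F ((Φ.flow r z) i)) Q := by
  have hm : AEStronglyMeasurable (fun z => F ((Φ.flow r z) i)) Q :=
    (hFc.measurable.comp ((measurable_pi_apply i).comp (Φ.measurable_flow r))).aestronglyMeasurable
  refine ((integrable_const C).add (hE.const_mul C)).mono' hm ?_
  filter_upwards [(mem_ae_iff.2 hQ : ∀ᵐ z ∂Q, z ∈ Φ.good)] with z hz
  rw [Real.norm_eq_abs, Pi.add_apply]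
  have h := lga_abs_obs_flow_le Φ hC0 hC hz r i
  linarith

/-- **Window Fubini for one particle.** Under the hypotheses of `lga_integrable_obs_flow` and for a
finite `Q`, the window integral `z ↦ ∫₀ʷ F((Φ_r z)ᵢ) dr` is `Q`-integrable, the one-time means
`r ↦ ∫ F((Φ_r z)ᵢ) dQ` are integrable on `[0, w]`, and the two iterated integrals agree. [folklore] -/
theorem lga_window_fubini [IsFiniteMeasure Q] (hFc : Continuous F) (hC0 : 0 ≤ C)
    (hC : ∀ y, |F y| ≤ C * (1 + ‖y.2‖ ^ 2)) (hQ : Q Φ.goodᶜ = 0)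
    (hE : Integrable (fun z : Config (N + 1) (Fin 3) T3 => ∑ j, ‖(z j).2‖ ^ 2) Q) {w : ℝ}
    (hw : 0 ≤ w) (i : Fin (N + 1)) :
    Integrable (fun z => ∫ r in (0 : ℝ)..w, F ((Φ.flow r z) i)) Q ∧
      IntervalIntegrable (fun r => ∫ z, F ((Φ.flow r z) i) ∂Q) volume 0 w ∧
      ∫ z, (∫ r in (0 : ℝ)..w, F ((Φ.flow r z) i)) ∂Q =
        ∫ r in (0 : ℝ)..w, ∫ z, F ((Φ.flow r z) i) ∂Q := by
  set ν : Measure ℝ := volume.restrict (Ioc (0 : ℝ) w) with hν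
  haveI : IsFiniteMeasure ν := by
    rw [hν]
    exact isFiniteMeasure_restrict.2 (by simp)
  set f : Config (N + 1) (Fin 3) T3 × ℝ → ℝ := fun p => F ((Φ.flow p.2 p.1) i) with hf
  have hfm : AEStronglyMeasurable f (Q.prod ν) :=
    (lga_aemeasurable_comp_flow_prod Φ (hFc.measurable.comp (measurable_pi_apply i)) hQ
      ν).aestronglyMeasurable
  have hint : Integrable f (Q.prod ν) := by
    refine ⟨hfm, ?_⟩
    have hdom : ∀ᵐ z ∂Q, ∀ r, ‖f (z, r)‖ₑ ≤ ENNReal.ofReal (C * (1 + ∑ j, ‖(z j).2‖ ^ 2)) := by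
      filter_upwards [(mem_ae_iff.2 hQ : ∀ᵐ z ∂Q, z ∈ Φ.good)] with z hz r
      rw [Real.enorm_eq_ofReal_abs]
      exact ENNReal.ofReal_le_ofReal (lga_abs_obs_flow_le Φ hC0 hC hz r i)
    have hEint : Integrable (fun z : Config (N + 1) (Fin 3) T3 => C * (1 + ∑ j, ‖(z j).2‖ ^ 2)) Q := by
      have := (integrable_const C).add (hE.const_mul C)
      refine this.congr (ae_of_all _ fun z => ?_)
      simp only [Pi.add_apply]
      ring
    have hfinE : ∫⁻ z, ENNReal.ofReal (C * (1 + ∑ j, ‖(z j).2‖ ^ 2)) ∂Q ≠ ⊤ :=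
      (lintegral_ofReal_ne_top_iff_integrable hEint.1 (ae_of_all _ fun z => by positivity)).2 hEint
    calc ∫⁻ p, ‖f p‖ₑ ∂(Q.prod ν)
        ≤ ∫⁻ z, ∫⁻ r, ‖f (z, r)‖ₑ ∂ν ∂Q := lintegral_prod_le _
      _ ≤ ∫⁻ z, ∫⁻ _r, ENNReal.ofReal (C * (1 + ∑ j, ‖(z j).2‖ ^ 2)) ∂ν ∂Q :=
          lintegral_mono_ae (hdom.mono fun z hz => lintegral_mono fun r => hz r)
      _ = (∫⁻ z, ENNReal.ofReal (C * (1 + ∑ j, ‖(z j).2‖ ^ 2)) ∂Q) * ν univ := by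
          rw [← lintegral_mul_const' _ _ (measure_ne_top ν _)]
          exact lintegral_congr fun z => lintegral_const _
      _ < ⊤ := ENNReal.mul_lt_top hfinE.lt_top (measure_lt_top ν _)
  refine ⟨?_, ?_, ?_⟩
  · have h := hint.integral_prod_left
    simp_rw [intervalIntegral.integral_of_le hw]
    exact h
  · exact (intervalIntegrable_iff_integrableOn_Ioc_of_le hw).2 hint.integral_prod_right
  · simp_rw [intervalIntegral.integral_of_le hw]
    exact integral_integral_swap (f := fun z r => F ((Φ.flow r z) i)) hint

/-- **Registered helper stub `stub_localGibbsLedgerAssemblyByName_prelim` — the window-mean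
identity.** For a hard-sphere flow `Φ` of `N + 1` spheres on `𝕋³`, a continuous one-body observable
`F` with `|F(x,v)| ≤ C(1+‖v‖²)` (`C ≥ 0`), a finite measure `Q` on phase space carried by the good set
under which the energy `Σⱼ‖vⱼ‖²` is integrable, and a window `w > 0`:
`∫ Σᵢ w⁻¹∫₀ʷ F((Φ_r z)ᵢ) dr dQ = w⁻¹ ∫₀ʷ Σᵢ ∫ F((Φ_r z)ᵢ) dQ dr` (Fubini over `[0,w] × phase
space`, term by term). [folklore] -/
theorem stub_localGibbsLedgerAssemblyByName_prelim :
    ∀ (σ : ℝ) (N : ℕ)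
      (Φ : HardSphereFlow (Literature.Analysis.FluidPDE.Torus.geometry (Fin 3)) (hsDiameter σ N) (N + 1))
      (F : T3 × V3 → ℝ), Continuous F → ∀ C : ℝ, 0 ≤ C → (∀ y, |F y| ≤ C * (1 + ‖y.2‖ ^ 2)) →
      ∀ (Q : Measure (Config (N + 1) (Fin 3) T3)) [IsFiniteMeasure Q], Q Φ.goodᶜ = 0 →
      Integrable (fun z : Config (N + 1) (Fin 3) T3 => ∑ j, ‖(z j).2‖ ^ 2) Q →
      ∀ w : ℝ, 0 < w →
        ∫ z, (∑ i, w⁻¹ * ∫ r in (0 : ℝ)..w, F ((Φ.flow r z) i)) ∂Q =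
          w⁻¹ * ∫ r in (0 : ℝ)..w, ∑ i, ∫ z, F ((Φ.flow r z) i) ∂Q := by
  intro σ N Φ F hFc C hC0 hC Q _ hQ hE w hw
  have hfub := fun i => lga_window_fubini Φ hFc hC0 hC hQ hE hw.le i
  rw [integral_finsetSum _ fun i _ => ((hfub i).1).const_mul w⁻¹]
  simp_rw [integral_const_mul, (hfub _).2.2]
  rw [intervalIntegral.integral_finsetSum fun i _ => (hfub i).2.1, Finset.mul_sum]

end Flow

end Summit.AtomisticToContinuum.HydrodynamicLimit.Theorems.KineticCurrentsWindowLDUniformLocalGibbs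

end
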